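import Mathlib.Analysis.InnerProductSpace.PiL2
import Literature.MathematicalPhysics.StatisticalMechanics.BarlowStacking

/-!
# Sub-windows of two-way matched windows (stub `stub_subwindow` of `StackingFaultSparsity`)

Elementary metric geometry used by the covering count of the line `Sketch` for the crux
`StackingFaultSparsity` (item stmt-AtomisticToContinuum-14296).

A window of particle `i₀` of a configuration `y : Fin N → E3` is *two-way `(L, ε')`-matched* to a
point set `S ⊆ E3` based at `z` after the linear isometry `A` when
* every point `p ∈ S` with `dist p z ≤ L` has its image `y i₀ + A (p - z)` within `ε'` of some
  particle, and
* every particle within `L` of `y i₀` is within `ε'` of the image of some point of `S`.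

`stub_subwindow`: if moreover the particle `i'` lies within `L / 2` of `y i₀` and within `ε'` of the
image of a point `p' ∈ S`, then the window of `i'` is two-way `(R, 2 ε')`-matched to the same `S`
based at `p'` after the same `A`, for every `R ≥ 0` with `R + L / 2 + ε' ≤ L`.

Proof: `A` is linear, so `y i' + A (q - p') = (y i₀ + A (q - z)) + (y i' - (y i₀ + A (p' - z)))`
and the last bracket has norm `≤ ε'`; the rest is the triangle inequality (twice for each clause)
together with `dist p' z = ‖A (p' - z)‖ ≤ ε' + L / 2`.
-/

noncomputable section
namespace Summit.AtomisticToContinuum.Crystallization.Theorems.SquareWellLayerCake.StackingFaultSparsity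
open Literature.MathematicalPhysics.StatisticalMechanics
/-- Euclidean `3`-space. [folklore] -/
local notation "E3" => EuclideanSpace ℝ (Fin 3)

/-- Re-centring identity: moving the base point of a matched window from `z` (particle `a`) to
`p'` (particle `b`) changes every image point by the fixed vector `b - (a + A (p' - z))`. -/
private theorem recentre (A : E3 →ₗᵢ[ℝ] E3) (a b q z p' : E3) :
    b + A (q - p') = (a + A (q - z)) + (b - (a + A (p' - z))) := by
  have h : A (q - p') = A (q - z) - A (p' - z) := by
    rw [← map_sub]
    congr 1
    abel
  rw [h]
  abel

/-- Distances to re-centred image points grow by at most the re-centring error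
`dist b (a + A (p' - z))`. -/
private theorem dist_recentre_le (A : E3 →ₗᵢ[ℝ] E3) (x a b q z p' : E3) :
    dist x (b + A (q - p')) ≤ dist x (a + A (q - z)) + dist b (a + A (p' - z)) := by
  rw [recentre A a b q z p']
  calc dist x ((a + A (q - z)) + (b - (a + A (p' - z))))
      ≤ dist x (a + A (q - z)) +
          dist (a + A (q - z)) ((a + A (q - z)) + (b - (a + A (p' - z)))) :=
        dist_triangle _ _ _
    _ = dist x (a + A (q - z)) + dist b (a + A (p' - z)) := by
        rw [dist_self_add_right, ← dist_eq_norm]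

/-- **Sub-window lemma** (`stub_subwindow`, pure metric geometry, any point set `S`; clauses of the
two-way match printed unfolded).  If the window of `i₀` is two-way `(L, ε')`-matched to `S` based at
`z` after `A`, and the particle `i'` lies within `L/2` of `y i₀` and within `ε'` of the image
`y i₀ + A (p' - z)` of a point `p' ∈ S`, then the window of `i'` is two-way `(R, 2ε')`-matched to `S`
based at `p'` after the same `A`, for every radius `R ≥ 0` with `R + L/2 + ε' ≤ L`. -/
theorem stub_subwindow :
    ∀ {N : ℕ} (y : Fin N → E3) (i₀ i' : Fin N) (S : Set E3) (z p' : E3) (A : E3 →ₗᵢ[ℝ] E3)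
      (L R ε' : ℝ), 0 ≤ ε' → 0 ≤ R → R + L / 2 + ε' ≤ L →
      ((∀ p ∈ S, dist p z ≤ L → ∃ j : Fin N, dist (y j) (y i₀ + A (p - z)) ≤ ε') ∧
        (∀ j : Fin N, dist (y j) (y i₀) ≤ L → ∃ p ∈ S, dist (y j) (y i₀ + A (p - z)) ≤ ε')) →
      p' ∈ S → dist (y i') (y i₀) ≤ L / 2 → dist (y i') (y i₀ + A (p' - z)) ≤ ε' →
      (∀ p ∈ S, dist p p' ≤ R → ∃ j : Fin N, dist (y j) (y i' + A (p - p')) ≤ 2 * ε') ∧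
        (∀ j : Fin N, dist (y j) (y i') ≤ R → ∃ p ∈ S, dist (y j) (y i' + A (p - p')) ≤ 2 * ε') := by
  intro N y i₀ i' S z p' A L R ε' hε' hR hRL hW hp' hi' hclose
  obtain ⟨hW₁, hW₂⟩ := hW
  -- the new base point `p'` is within `L / 2 + ε'` of the old one
  have hpz : dist p' z ≤ L / 2 + ε' := by
    have h1 : dist p' z = dist (y i₀ + A (p' - z)) (y i₀) := by
      rw [dist_self_add_left, LinearIsometry.norm_map, dist_eq_norm]
    rw [h1]
    calc dist (y i₀ + A (p' - z)) (y i₀)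
        ≤ dist (y i₀ + A (p' - z)) (y i') + dist (y i') (y i₀) := dist_triangle _ _ _
      _ ≤ ε' + L / 2 := by rw [dist_comm]; exact add_le_add hclose hi'
      _ = L / 2 + ε' := add_comm _ _
  refine ⟨?_, ?_⟩
  · -- first clause: stacking points near `p'` are near `z`, hence matched in the big window
    intro q hq hqp
    have hqz : dist q z ≤ L := by
      calc dist q z ≤ dist q p' + dist p' z := dist_triangle _ _ _
        _ ≤ R + (L / 2 + ε') := add_le_add hqp hpz
        _ ≤ L := by linarith
    obtain ⟨j, hj⟩ := hW₁ q hq hqz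
    refine ⟨j, ?_⟩
    calc dist (y j) (y i' + A (q - p'))
        ≤ dist (y j) (y i₀ + A (q - z)) + dist (y i') (y i₀ + A (p' - z)) :=
          dist_recentre_le A _ _ _ _ _ _
      _ ≤ ε' + ε' := add_le_add hj hclose
      _ = 2 * ε' := by ring
  · -- second clause: particles near `y i'` are near `y i₀`, hence matched in the big window
    intro j hj
    have hj₀ : dist (y j) (y i₀) ≤ L := by
      calc dist (y j) (y i₀) ≤ dist (y j) (y i') + dist (y i') (y i₀) := dist_triangle _ _ _
        _ ≤ R + L / 2 := add_le_add hj hi'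
        _ ≤ L := by linarith
    obtain ⟨q, hq, hjq⟩ := hW₂ j hj₀
    refine ⟨q, hq, ?_⟩
    calc dist (y j) (y i' + A (q - p'))
        ≤ dist (y j) (y i₀ + A (q - z)) + dist (y i') (y i₀ + A (p' - z)) :=
          dist_recentre_le A _ _ _ _ _ _
      _ ≤ ε' + ε' := add_le_add hjq hclose
      _ = 2 * ε' := by ring

end Summit.AtomisticToContinuum.Crystallization.Theorems.SquareWellLayerCake.StackingFaultSparsity

end
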